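import Literature.Barriers.SmoothPoincare4.ExoticOpenFourSpace
import Literature.AlgebraicTopology.FundamentalGroup.RotationGroupSO3
import Mathlib.Topology.Homotopy.Lifting
import HarnessLib

/-!
# `deMichelisFreedman1992_continuum`: Thm. 2.1, Point 4, Lemma 2.3 — `SO(3)` is centerless, the
# adjoint action lifts through the two-fold cover `SU(2) → SO(3)`, sections lift over a simply
# connected base, and based sections normalise to the identity near the base point

Proof file in the cone of the named fact
`Literature.Barriers.SmoothPoincare4.deMichelisFreedman1992_continuum` (DeMichelis–Freedman 1992,
Thm. 4.1 with Cor. 4.1: continuum many pairwise non-diffeomorphic open subsets of standard `ℝ⁴`,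
each homeomorphic to `ℝ⁴`; `ExoticOpenFourSpace.lean`), sibling of
`ExoticOpenFourSpaceGaugeAlgebraProofs` (Point 3 (2.16)–(2.18), App. A (A.5)). What the cone leaves
of the printed proof is the gauge theory of Thm. 2.1 ("`Φ` commutes with geometric limit",
pp. 224–233); THIS FILE renders the two GROUP-THEORETIC inputs of the orientation argument,
Point 4, Lemma 2.3 (p. 233), against the tree's rotation group
(`Literature.AlgebraicTopology.FundamentalGroup.RotationGroupSO3`: `SO3`, the two-fold covering
homomorphism `rotHom : S³ →* SO(3)` from the unit quaternions `S³ = Sp(1) ≅ SU(2)`, surjective with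
kernel `{±1}`).

Lemma 2.3 (p. 233): "`Λ_c` is trivial." Its proof (verbatim): "We will prove that `𝔅̃_c` is simply
connected. First, `𝔅̃_c` is homotopy equivalent to `𝔅̃`, the space of connections on `E → M`
modulo the pointed gauge group `𝒢₀`. **Since `SO(3)` is centerless**, […]. Thus it is sufficient to
check that `𝒢₀` is connected. The pointed gauge group `𝒢₀` may be described as the space of base
point preserving sections of the adjoint bundle `Γ(Ad_{SO(3)})`. **The adjoint representation lifts
to `SO(3) → Aut(SU(2))` by `x ↦ (g → π⁻¹(x) g (π⁻¹(x))⁻¹)`, with `π : SU(2) → SO(3)` the two-fold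
cover**; then `Ad_{SU(2)} → Ad_{SO(3)}` is also a two-fold cover. Since the base `M` is simply
connected, any section of `Ad_{SO(3)}` lifts to a section of `Ad_{SU(2)}` […]"

PROVED here (the unit quaternions `Metric.sphere (0 : ℍ) 1` with Mathlib's group structure standing
for `SU(2)`, and the tree's `rotHom` for `π`):

* `SO3.eq_one_of_forall_commute`, `SO3.center_eq_bot` — **`SO(3)` is centerless**: a rotation
  commuting with the half-turns `diag(1,−1,−1)`, `diag(−1,1,−1)` is diagonal, commuting with the
  quarter-turns about the first two axes makes it scalar, and a scalar matrix in `SO(3)` is `𝟙`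
  (`a² = 1`, `a³ = 1`);
* `conj_neg_sphere` — conjugation by `−q` equals conjugation by `q` on `S³` (`−1` is central);
  `conj_eq_of_rotHom_eq` — unit quaternions over the same rotation induce the same inner
  automorphism (the fibre is `{q, −q}`, kernel `{±1}`);
* `so3Lift x` — a chosen preimage `π⁻¹(x)`; `adLift : SO3 →* MulAut S³` — **the lift of the adjoint
  representation**, `x ↦ (g ↦ π⁻¹(x) g π⁻¹(x)⁻¹)`, a well-defined group homomorphism;
  `adLift_rotHom` — `adLift (π q) = conj_q` (it lifts `Ad ∘ π = π ∘ conj`); `rotHom_adLift` —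
  `π (adLift x g) = x π(g) x⁻¹` (it covers the adjoint action of `SO(3)`); `adLift_unique` — it is
  the only map `SO(3) → Aut(S³)` through which conjugation factors;
* (section `Lifting`, trivialised adjoint bundles, sections = continuous maps with the compact-open
  topology) `existsUnique_lift_rotHom`, `exists_based_lift_rotHom` — **"Since the base `M` is simply
  connected, any section of `Ad_{SO(3)}` lifts to a section of `Ad_{SU(2)}`"** (Mathlib's lifting
  criterion `IsCoveringMap.existsUnique_continuousMap_lifts` for the tree's `isCoveringMap_rotHom`;
  based sections lift to based sections); `lift_rotHom_unique`, `lift_rotHom_eq_or_eq_neg` — over a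
  connected base the lifts of a section are `g` and `−g`; `continuous_comp_rotHomC`,
  `image_comp_rotHomC_based`, `joinedIn_based_of_lift` — **"an arc in `𝒢̃₀` may be projected to
  `𝒢₀`"** (post-composition with `π` is continuous and maps the based sections of `Ad_{SU(2)}` onto
  those of `Ad_{SO(3)}`); `isPathConnected_based_SO3_of_sphere` — the printed reduction **"it is
  sufficient to check that `Γ(Ad_{SU(2)}) = 𝒢̃₀` is connected"**: `π₀(𝒢̃₀) = 0 ⇒ π₀(𝒢₀) = 0`.

* (section `Normalisation`) **"Since `SU(2)` is [locally] connected, any section can be normalized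
  to be the identity on a disk `D` containing the base point of `M`"** — for maps into the unit
  sphere `S(E)` of ANY real normed space (so for `S³ ⊂ ℍ`) and any topological base:
  `segment_sphere_ne_zero` (the segment from `q` to `e` on the unit sphere misses the origin unless
  `q = −e`), `exists_homotopy_based_eq_near` — the straight-line homotopy `(1 − tφ)g + tφe` pushed
  back radially, with the cut-off `φ = ρ(‖g − e‖)` pulled back from the TARGET (no separation
  hypothesis on `M`), is a based homotopy from `g` to a map `≡ e` on the neighbourhood
  `{‖g − e‖ < 1/2}` of `x₀`, stationary where `‖g − e‖ ≥ 1`; `exists_joinedIn_based_eq_near`,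
  `exists_joinedIn_based_eq_one_near` — the same as an arc of based sections (compact-open
  topology); `isPathConnected_based_of_normalised`, `isPathConnected_based_SO3_of_normalised` —
  the assembled reduction: `𝒢₀` is path connected as soon as any two based sections of
  `Ad_{SU(2)}` that are the identity near the base point are joined by an arc of based sections.

NOT rendered: non-trivial adjoint bundles (`Ad_{SU(2)} → Ad_{SO(3)}` as a two-fold cover of
bundles; the printed proof itself passes to the trivial bundle over `M ∖ D`), `π₀ Maps(M, S³)_* = 0`
(cited from [10, Prop. (5.12)], not proved in the source), the determinant line bundles `Λ`, and the
identification `Sp(1) ≅ SU(2)`; no named fact is introduced (D-0026).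

## References

* S. DeMichelis, M. H. Freedman, *Uncountably many exotic `R⁴`'s in standard 4-space*,
  J. Differential Geom. 35 (1992) 219–254: §2, Point 4, Lemma 2.3 and its proof, p. 233
  [DeMichelisFreedman1992].
* A. Hatcher, *Algebraic Topology* (2002), §3.D (the homomorphism `S³ → SO(3)`, surjective with
  kernel `{±1}`), Props. 1.33–1.34 (lifting criterion, uniqueness of lifts) [HatcherAT2002].

[DeMichelisFreedman1992]
-/

noncomputable section

open Matrix Filter
open scoped Quaternion Topology
open Literature.AlgebraicTopology.FundamentalGroup

namespace Literature.Barriers.SmoothPoincare4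

/-! ### `SO(3)` is centerless -/

namespace SO3Center

/-- Entry `(i, j)` of a commutation relation `A Z = Z A` of `3 × 3` matrices, expanded. [folklore] -/
theorem apply_comm_eq {A Z : Matrix (Fin 3) (Fin 3) ℝ} (h : A * Z = Z * A) (i j : Fin 3) :
    A i 0 * Z 0 j + A i 1 * Z 1 j + A i 2 * Z 2 j = Z i 0 * A 0 j + Z i 1 * A 1 j + Z i 2 * A 2 j := by
  have := congrFun (congrFun h i) j
  simpa [Matrix.mul_apply, Fin.sum_univ_three] using this

end SO3Center

open SO3Center in
/-- **A rotation commuting with every rotation is the identity** (`SO(3)` is centerless — the fact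
used in the proof of Lemma 2.3, p. 233: "Since `SO(3)` is centerless"). Proof: commuting with the
half-turns `diag(1,−1,−1) = rotX(−1,0)` and `diag(−1,1,−1) = rotY(−1,0)` kills the off-diagonal
entries; commuting with the quarter-turns `rotX(0,1)`, `rotY(0,1)` equates the diagonal entries;
a scalar `a𝟙 ∈ SO(3)` has `a² = 1` (orthogonality) and `a³ = 1` (determinant), so `a = 1`.
[cite: DeMichelisFreedman1992, §2 Lemma 2.3 (proof), p. 233] -/
theorem SO3.eq_one_of_forall_commute (Z : SO3) (hZ : ∀ g : SO3, g * Z = Z * g) : Z = 1 := by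
  -- the four test rotations, as elements of `SO(3)` (images of unit quaternions)
  have hu : ((-1 : ℝ)) ^ 2 + (0 : ℝ) ^ 2 = 1 := by norm_num
  have hq : ((0 : ℝ)) ^ 2 + (1 : ℝ) ^ 2 = 1 := by norm_num
  obtain ⟨qx, hqx⟩ := rotX_mem_range (-1) 0 hu
  obtain ⟨qy, hqy⟩ := rotY_mem_range (-1) 0 hu
  obtain ⟨rx, hrx⟩ := rotX_mem_range 0 1 hq
  obtain ⟨ry, hry⟩ := rotY_mem_range 0 1 hq
  have cx : rotX (-1) 0 * Z.1 = Z.1 * rotX (-1) 0 := by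
    simpa [hqx] using congrArg Subtype.val (hZ (rotHom qx))
  have cy : rotY (-1) 0 * Z.1 = Z.1 * rotY (-1) 0 := by
    simpa [hqy] using congrArg Subtype.val (hZ (rotHom qy))
  have dx : rotX 0 1 * Z.1 = Z.1 * rotX 0 1 := by
    simpa [hrx] using congrArg Subtype.val (hZ (rotHom rx))
  have dy : rotY 0 1 * Z.1 = Z.1 * rotY 0 1 := by
    simpa [hry] using congrArg Subtype.val (hZ (rotHom ry))
  -- off-diagonal entries vanish
  have z01 : Z.1 0 1 = 0 := by have := apply_comm_eq cx 0 1; simp [rotX] at this; linarith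
  have z02 : Z.1 0 2 = 0 := by have := apply_comm_eq cx 0 2; simp [rotX] at this; linarith
  have z10 : Z.1 1 0 = 0 := by have := apply_comm_eq cx 1 0; simp [rotX] at this; linarith
  have z20 : Z.1 2 0 = 0 := by have := apply_comm_eq cx 2 0; simp [rotX] at this; linarith
  have z12 : Z.1 1 2 = 0 := by have := apply_comm_eq cy 1 2; simp [rotY] at this; linarith
  have z21 : Z.1 2 1 = 0 := by have := apply_comm_eq cy 2 1; simp [rotY] at this; linarith
  -- diagonal entries agree
  have d12 : Z.1 1 1 = Z.1 2 2 := by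
    have := apply_comm_eq dx 1 2; simp [rotX, z12] at this; linarith
  have d02 : Z.1 0 0 = Z.1 2 2 := by
    have := apply_comm_eq dy 0 2; simp [rotY, z02] at this; linarith
  -- the scalar is `1`
  set a : ℝ := Z.1 2 2 with ha
  have hsq : a ^ 2 = 1 := by
    have h := congrFun (congrFun Z.2.1 0) 0
    simp [Matrix.mul_apply, Fin.sum_univ_three, z10, z20] at h
    rw [d02] at h
    nlinarith [h]
  have hcube : a ^ 3 = 1 := by
    have h := Z.2.2
    rw [Matrix.det_fin_three, z01, z02, z10, z12, z20, z21, d02, d12] at h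
    nlinarith [h]
  have ha1 : a = 1 := by
    calc a = a * a ^ 2 := by rw [hsq, mul_one]
      _ = a ^ 3 := by ring
      _ = 1 := hcube
  -- conclude
  refine Subtype.ext ?_
  ext i j
  fin_cases i <;> fin_cases j <;>
    simp [z01, z02, z10, z12, z20, z21, d02, d12] <;> exact ha1

/-- **`SO(3)` is centerless**: `Z(SO(3)) = 1` (proof of Lemma 2.3, p. 233: "Since `SO(3)` is
centerless, […]"). [cite: DeMichelisFreedman1992, §2 Lemma 2.3 (proof), p. 233] -/
theorem SO3.center_eq_bot : Subgroup.center SO3 = ⊥ := by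
  rw [Subgroup.eq_bot_iff_forall]
  intro Z hZ
  exact SO3.eq_one_of_forall_commute Z (Subgroup.mem_center_iff.1 hZ)

/-! ### The adjoint representation lifts through the two-fold cover -/

/-- The coercion of `−q` for unit quaternions. [folklore] -/
theorem coe_neg_sphere (q : Metric.sphere (0 : ℍ) 1) : ((-q : Metric.sphere (0 : ℍ) 1) : ℍ) = -q :=
  rfl

/-- `(−q)⁻¹ = −q⁻¹` for unit quaternions. [folklore] -/
theorem neg_inv_sphere (q : Metric.sphere (0 : ℍ) 1) : (-q)⁻¹ = -q⁻¹ :=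
  Subtype.ext (by
    rw [Metric.unitSphere.coe_inv, coe_neg_sphere, coe_neg_sphere, Metric.unitSphere.coe_inv,
      neg_inv])

/-- **`−1` is central: conjugation by `−q` is conjugation by `q`** on `S³`. [folklore] -/
theorem conj_neg_sphere (q : Metric.sphere (0 : ℍ) 1) : MulAut.conj (-q) = MulAut.conj q := by
  refine MulEquiv.ext fun p ↦ ?_
  rw [MulAut.conj_apply, MulAut.conj_apply]
  refine Subtype.ext ?_
  simp only [Metric.unitSphere.coe_mul, Metric.unitSphere.coe_inv, coe_neg_sphere]
  rw [← neg_inv, neg_mul, neg_mul_neg]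

/-- **Unit quaternions over the same rotation induce the same inner automorphism of `S³`**: the
fibre of `π : S³ → SO(3)` over `π(q)` is `{q, −q}` (kernel `{±1}`), and `conj_{−q} = conj_q`.
[cite: HatcherAT2002, §3.D (kernel ℤ₂ = {±1})] -/
theorem conj_eq_of_rotHom_eq {q q' : Metric.sphere (0 : ℍ) 1} (h : rotHom q = rotHom q') :
    MulAut.conj q = MulAut.conj q' := by
  have hk : q⁻¹ * q' ∈ rotHom.ker := by
    rw [MonoidHom.mem_ker, map_mul, map_inv, h, inv_mul_cancel]
  rcases (mem_ker_rotHom_iff _).1 hk with h1 | h1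
  · rw [inv_mul_eq_one] at h1
    rw [h1]
  · rw [inv_mul_eq_iff_eq_mul] at h1
    have hq' : q' = -q := h1.trans (Subtype.ext (by
      rw [Metric.unitSphere.coe_mul, coe_neg_sphere, coe_neg_sphere, Metric.unitSphere.coe_one,
        mul_neg_one]))
    rw [hq', conj_neg_sphere]

/-- A chosen preimage `π⁻¹(x) ∈ S³` of a rotation `x ∈ SO(3)` under the two-fold cover
(`surjective_rotHom`). [cite: DeMichelisFreedman1992, §2 Lemma 2.3 (proof), p. 233] -/
def so3Lift (x : SO3) : Metric.sphere (0 : ℍ) 1 :=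
  Classical.choose (surjective_rotHom x)

/-- `π (so3Lift x) = x`. [folklore] -/
@[simp] theorem rotHom_so3Lift (x : SO3) : rotHom (so3Lift x) = x :=
  Classical.choose_spec (surjective_rotHom x)

/-- **The lift of the adjoint representation of `SO(3)` to automorphisms of `S³ ≅ SU(2)`**
(proof of Lemma 2.3, p. 233: "The adjoint representation lifts to `SO(3) → Aut(SU(2))` by
`x ↦ (g → π⁻¹(x) g (π⁻¹(x))⁻¹)`, with `π : SU(2) → SO(3)` the two-fold cover"): a well-defined group
homomorphism, independent of the choice of `π⁻¹(x)` by `conj_eq_of_rotHom_eq`.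
[cite: DeMichelisFreedman1992, §2 Lemma 2.3 (proof), p. 233] -/
def adLift : SO3 →* MulAut (Metric.sphere (0 : ℍ) 1) where
  toFun x := MulAut.conj (so3Lift x)
  map_one' := by
    rw [← map_one MulAut.conj]
    exact conj_eq_of_rotHom_eq (by rw [rotHom_so3Lift, map_one])
  map_mul' x y := by
    rw [← map_mul]
    exact conj_eq_of_rotHom_eq (by rw [rotHom_so3Lift, map_mul, rotHom_so3Lift, rotHom_so3Lift])

/-- Unfolding `adLift`. [folklore] -/
theorem adLift_apply (x : SO3) : adLift x = MulAut.conj (so3Lift x) := rfl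

/-- **`adLift` lifts the adjoint representation along `π`: `adLift (π q) = conj_q`**, i.e.
`adLift (π q) g = q g q⁻¹` — the printed formula `x ↦ (g → π⁻¹(x) g (π⁻¹(x))⁻¹)` is independent of
the choice of `π⁻¹(x)`. [cite: DeMichelisFreedman1992, §2 Lemma 2.3 (proof), p. 233] -/
theorem adLift_rotHom (q : Metric.sphere (0 : ℍ) 1) : adLift (rotHom q) = MulAut.conj q :=
  conj_eq_of_rotHom_eq (rotHom_so3Lift _)

/-- `adLift (π q) g = q g q⁻¹`. [cite: DeMichelisFreedman1992, §2 Lemma 2.3 (proof), p. 233] -/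
theorem adLift_rotHom_apply (q g : Metric.sphere (0 : ℍ) 1) : adLift (rotHom q) g = q * g * q⁻¹ := by
  rw [adLift_rotHom, MulAut.conj_apply]

/-- **`adLift` covers the adjoint action of `SO(3)` on itself**: `π (adLift x g) = x π(g) x⁻¹`
(so `adLift x` is the lift to the cover `S³ → SO(3)` of the inner automorphism `Ad_x` of `SO(3)`).
[cite: DeMichelisFreedman1992, §2 Lemma 2.3 (proof), p. 233] -/
theorem rotHom_adLift (x : SO3) (g : Metric.sphere (0 : ℍ) 1) :
    rotHom (adLift x g) = x * rotHom g * x⁻¹ := by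
  obtain ⟨q, rfl⟩ := surjective_rotHom x
  rw [adLift_rotHom_apply, map_mul, map_mul, map_inv]

/-- **Uniqueness of the lift**: a map `SO(3) → Aut(S³)` through which conjugation factors along `π`
is `adLift` (`π` is surjective). [folklore] -/
theorem adLift_unique (φ : SO3 → MulAut (Metric.sphere (0 : ℍ) 1))
    (hφ : ∀ q, φ (rotHom q) = MulAut.conj q) : φ = adLift := by
  funext x
  obtain ⟨q, rfl⟩ := surjective_rotHom x
  rw [hφ, adLift_rotHom]

/-- The kernel of `adLift` is trivial: a rotation acting trivially on `S³` is central in `SO(3)`,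
hence `𝟙` (`SO3.eq_one_of_forall_commute`). [folklore] -/
theorem adLift_injective : Function.Injective adLift := by
  rw [← MonoidHom.ker_eq_bot_iff, Subgroup.eq_bot_iff_forall]
  intro x hx
  rw [MonoidHom.mem_ker] at hx
  refine SO3.eq_one_of_forall_commute x fun g ↦ ?_
  obtain ⟨p, rfl⟩ := surjective_rotHom g
  have h := rotHom_adLift x p
  rw [hx, MulAut.one_apply] at h
  -- `π p = x π p x⁻¹`
  calc rotHom p * x = x * rotHom p * x⁻¹ * x := by rw [← h]
    _ = x * rotHom p := by rw [inv_mul_cancel_right]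

/-! ### Sections lift over a simply connected base; arcs of lifted sections project

Proof of Lemma 2.3, continued (p. 233): "then `Ad_{SU(2)} → Ad_{SO(3)}` is also a two-fold cover.
**Since the base `M` is simply connected, any section of `Ad_{SO(3)}` lifts to a section of
`Ad_{SU(2)}`. It is sufficient to check that `Γ(Ad_{SU(2)}) = 𝒢̃₀` is connected since an arc in
`𝒢̃₀` may be projected to `𝒢₀`.**" Rendered for the TRIVIALISED adjoint bundles (the case the
printed proof reduces to two sentences later: "over the complement `M ∖ D` the bundle is trivial"),
where (base point preserving) sections are (based) continuous maps `M → SO(3)`, resp. `M → S³`, with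
the compact-open topology, and the covering `Ad_{SU(2)} → Ad_{SO(3)}` is post-composition with
`π = rotHom`. -/

section Lifting

variable {M : Type*} [TopologicalSpace M]

/-- The two-fold cover `π : S³ → SO(3)` as a bundled continuous map. [folklore] -/
abbrev rotHomC : C(Metric.sphere (0 : ℍ) 1, SO3) := ⟨rotHom, continuous_rotHom⟩

/-- `rotHomC` is `rotHom` pointwise. [folklore] -/
@[simp] theorem rotHomC_apply (q : Metric.sphere (0 : ℍ) 1) : rotHomC q = rotHom q := rfl

/-- **Sections of `Ad_{SO(3)}` over a simply connected base lift to sections of `Ad_{SU(2)}`**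
(trivialised bundles; Lemma 2.3, p. 233: "Since the base `M` is simply connected, any section of
`Ad_{SO(3)}` lifts to a section of `Ad_{SU(2)}`"): a continuous `f : M → SO(3)` on a simply
connected, locally path connected `M` lifts UNIQUELY through the two-fold cover `π : S³ → SO(3)`
once the lift of one value is prescribed (Mathlib's lifting criterion
`IsCoveringMap.existsUnique_continuousMap_lifts` for the tree's covering map `isCoveringMap_rotHom`).
[cite: DeMichelisFreedman1992, §2 Lemma 2.3 (proof), p. 233] -/
theorem existsUnique_lift_rotHom [SimplyConnectedSpace M] [LocallyPathConnectedSpace M]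
    (f : C(M, SO3)) (x₀ : M) (q₀ : Metric.sphere (0 : ℍ) 1) (h : rotHom q₀ = f x₀) :
    ∃! g : C(M, Metric.sphere (0 : ℍ) 1), g x₀ = q₀ ∧ rotHom ∘ g = f :=
  isCoveringMap_rotHom.existsUnique_continuousMap_lifts f x₀ q₀ h

/-- **Based sections lift to based sections**: a continuous `f : M → SO(3)` with `f x₀ = 𝟙` on a
simply connected, locally path connected `M` is `π ∘ g` for a continuous `g : M → S³` with
`g x₀ = 1` (the pointed gauge group `𝒢₀` is covered by `𝒢̃₀`).
[cite: DeMichelisFreedman1992, §2 Lemma 2.3 (proof), p. 233] -/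
theorem exists_based_lift_rotHom [SimplyConnectedSpace M] [LocallyPathConnectedSpace M]
    (f : C(M, SO3)) (x₀ : M) (hf : f x₀ = 1) :
    ∃ g : C(M, Metric.sphere (0 : ℍ) 1), g x₀ = 1 ∧ rotHomC.comp g = f := by
  obtain ⟨g, ⟨hg₀, hg⟩, -⟩ := existsUnique_lift_rotHom f x₀ 1 (by rw [map_one, hf])
  exact ⟨g, hg₀, ContinuousMap.ext fun x ↦ congrFun hg x⟩

/-- **Uniqueness of lifted sections** over a connected base: two lifts of the same `f : M → SO(3)`
through `π` that agree at one point agree everywhere (`IsCoveringMap.eq_of_comp_eq`). [folklore] -/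
theorem lift_rotHom_unique [PreconnectedSpace M] {g g' : C(M, Metric.sphere (0 : ℍ) 1)}
    (h : rotHomC.comp g = rotHomC.comp g') (x₀ : M) (h₀ : g x₀ = g' x₀) : g = g' := by
  refine ContinuousMap.ext (congrFun (isCoveringMap_rotHom.eq_of_comp_eq g.continuous g'.continuous
    ?_ x₀ h₀))
  funext x
  exact DFunLike.congr_fun h x

/-- The two lifts of a based section over a connected base with prescribed based value: a lift
`g'` of `π ∘ g` is `g` or `−g` according as `g' x₀ = ± g x₀`. [folklore] -/
theorem lift_rotHom_eq_or_eq_neg [PreconnectedSpace M] {g g' : C(M, Metric.sphere (0 : ℍ) 1)}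
    (h : rotHomC.comp g' = rotHomC.comp g) (x₀ : M) :
    g' = g ∨ g' = -g := by
  have hk : (g x₀)⁻¹ * g' x₀ ∈ rotHom.ker := by
    rw [MonoidHom.mem_ker, map_mul, map_inv]
    have := DFunLike.congr_fun h x₀
    simp only [ContinuousMap.comp_apply, rotHomC_apply] at this
    rw [this, inv_mul_cancel]
  rcases (mem_ker_rotHom_iff _).1 hk with h1 | h1
  · left
    rw [inv_mul_eq_one] at h1
    exact lift_rotHom_unique h x₀ h1.symm
  · right
    rw [inv_mul_eq_iff_eq_mul] at h1
    refine lift_rotHom_unique ?_ x₀ ?_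
    · rw [h]
      ext x : 1
      simp only [ContinuousMap.comp_apply, rotHomC_apply, ContinuousMap.neg_apply]
      -- `π(−q) = π(q)`
      refine Subtype.ext ?_
      rw [coe_rotHom, coe_rotHom, coe_neg_sphere, quatRot_neg]
    · rw [h1, ContinuousMap.neg_apply]
      refine Subtype.ext ?_
      rw [Metric.unitSphere.coe_mul, coe_neg_sphere, coe_neg_sphere, Metric.unitSphere.coe_one,
        mul_neg_one]

/-- **Projection of sections is continuous** (compact-open topologies): `g ↦ π ∘ g`. [folklore] -/
theorem continuous_comp_rotHomC :
    Continuous (fun g : C(M, Metric.sphere (0 : ℍ) 1) ↦ rotHomC.comp g) :=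
  ContinuousMap.continuous_postcomp rotHomC

/-- The projection `g ↦ π ∘ g` maps based sections of `Ad_{SU(2)}` ONTO the based sections of
`Ad_{SO(3)}` when the base is simply connected and locally path connected. [cite: DeMichelisFreedman1992, §2 Lemma 2.3 (proof), p. 233] -/
theorem image_comp_rotHomC_based [SimplyConnectedSpace M] [LocallyPathConnectedSpace M] (x₀ : M) :
    (fun g : C(M, Metric.sphere (0 : ℍ) 1) ↦ rotHomC.comp g) '' {g | g x₀ = 1} =
      {f : C(M, SO3) | f x₀ = 1} := by
  ext f
  constructor
  · rintro ⟨g, hg, rfl⟩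
    have hg : g x₀ = 1 := hg
    simp [hg]
  · intro hf
    obtain ⟨g, hg₀, hg⟩ := exists_based_lift_rotHom f x₀ hf
    exact ⟨g, hg₀, hg⟩

/-- **"An arc in `𝒢̃₀` may be projected to `𝒢₀`"**: two based sections of (trivialised) `Ad_{SO(3)}`
whose based lifts are joined by an arc of based sections of `Ad_{SU(2)}` are joined by an arc of
based sections (the projected arc). [cite: DeMichelisFreedman1992, §2 Lemma 2.3 (proof), p. 233] -/
theorem joinedIn_based_of_lift (x₀ : M) {g g' : C(M, Metric.sphere (0 : ℍ) 1)}
    (h : JoinedIn {g | g x₀ = 1} g g') :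
    JoinedIn {f : C(M, SO3) | f x₀ = 1} (rotHomC.comp g) (rotHomC.comp g') := by
  have := h.map (f := fun g : C(M, Metric.sphere (0 : ℍ) 1) ↦ rotHomC.comp g)
    continuous_comp_rotHomC
  refine this.mono ?_
  rintro _ ⟨k, hk, rfl⟩
  have hk : k x₀ = 1 := hk
  simp [hk]

/-- **Lemma 2.3's reduction "it is sufficient to check that `Γ(Ad_{SU(2)}) = 𝒢̃₀` is connected"**
(trivialised bundles over a simply connected, locally path connected base): if the based sections
of `Ad_{SU(2)}` form a path connected subspace of `C(M, S³)`, then the based sections of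
`Ad_{SO(3)}` — the pointed gauge group `𝒢₀` — form a path connected subspace of `C(M, SO(3))`
(every based section lifts to a based section, and arcs project).
[cite: DeMichelisFreedman1992, §2 Lemma 2.3 (proof), p. 233] -/
theorem isPathConnected_based_SO3_of_sphere [SimplyConnectedSpace M] [LocallyPathConnectedSpace M]
    (x₀ : M) (h : IsPathConnected {g : C(M, Metric.sphere (0 : ℍ) 1) | g x₀ = 1}) :
    IsPathConnected {f : C(M, SO3) | f x₀ = 1} := by
  rw [← image_comp_rotHomC_based x₀]
  exact h.image' continuous_comp_rotHomC.continuousOn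

end Lifting

/-! ### Lemma 2.3, continued: "any section can be normalized to be the identity on a disk `D`
containing the base point of `M`"

The printed sentence (p. 233): "Since `SU(2)` is locally connected, any section can be normalized to
be the identity on a disk `D` containing the base point of `M`."  For the trivialised bundle the
sections are maps `M → S³`; we prove the normalisation for maps into the unit sphere `S(E)` of any
real normed space `E` with base value `e` (for `S³ ⊂ ℍ`, `e = 1`), over any topological space `M`,
by an explicit based homotopy. -/

section Normalisation

variable {M : Type*} [TopologicalSpace M]
variable {E : Type*} [NormedAddCommGroup E] [NormedSpace ℝ E]

/-- The algebraic core of the normalising homotopy: on the unit sphere of a real normed space, the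
segment from `q` to `e` misses the origin unless `q = -e` (and its initial point `q` is never the
origin): `(1 - s) • q + s • e = 0` with `0 ≤ s ≤ 1` forces `s = 1/2` and `q = -e`. [folklore] -/
theorem segment_sphere_ne_zero {q e : E} (hq : ‖q‖ = 1) (he : ‖e‖ = 1) {s : ℝ} (hs0 : 0 ≤ s)
    (hs1 : s ≤ 1) (h : s = 0 ∨ q ≠ -e) : (1 - s) • q + s • e ≠ 0 := by
  intro H
  have h1 : (1 - s) • q = -(s • e) := eq_neg_of_add_eq_zero_left H
  have h2 : 1 - s = s := by
    have := congrArg norm h1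
    rwa [norm_smul, norm_neg, norm_smul, hq, he, mul_one, mul_one, Real.norm_eq_abs,
      Real.norm_eq_abs, abs_of_nonneg (sub_nonneg.mpr hs1), abs_of_nonneg hs0] at this
  have hs : s = 1 / 2 := by linarith
  rcases h with h | h
  · norm_num [h] at hs
  · apply h
    have h3 : (1 / 2 : ℝ) • q = (1 / 2 : ℝ) • (-e) := by
      rw [smul_neg, ← hs, ← h1, hs]; norm_num
    exact smul_right_injective E (by norm_num : (1 / 2 : ℝ) ≠ 0) h3

/-- A point of the unit sphere at distance `< 1` from `e` is not the antipode `-e` (which is at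
distance `2`). [folklore] -/
theorem ne_neg_of_norm_sub_lt_one {q e : E} (he : ‖e‖ = 1) (h : ‖q - e‖ < 1) : q ≠ -e := by
  rintro rfl
  have : ‖-e - e‖ = 2 := by
    rw [← neg_add', norm_neg, ← two_smul ℝ e, norm_smul, he, mul_one, Real.norm_eq_abs, abs_two]
  linarith

/-- **Normalising a based map into a sphere to be constant near the base point** (Lemma 2.3, p. 233:
"any section can be normalized to be the identity on a disk `D` containing the base point of `M`";
here for sections of a trivialised bundle, i.e. maps, with fibre the unit sphere of any real normed
space and `e` the base value).  For a continuous `g : M → S(E)` with `g x₀ = e` there is a homotopy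
`H : [0,1] × M → S(E)` with `H₀ = g`, `H_t x₀ = e` for all `t` (it stays based), `H₁ ≡ e` on the
neighbourhood `{x | ‖g x - e‖ < 1/2}` of `x₀`, and `H_t x = g x` wherever `‖g x - e‖ ≥ 1` (the
deformation is local).  It is the straight-line homotopy `(1 - tφ) g + tφ e` pushed back to the
sphere radially, `φ = ρ(‖g - e‖)` a cut-off equal to `1` where `‖g - e‖ ≤ 1/2` and to `0` where
`‖g - e‖ ≥ 1`; the segment misses the origin because `g ≠ -e` on the support of `φ`
(`segment_sphere_ne_zero`).  No separation hypothesis on `M` is needed: the cut-off is pulled back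
from the target. [cite: DeMichelisFreedman1992, §2 Lemma 2.3 (proof), p. 233] -/
theorem exists_homotopy_based_eq_near (g : C(M, Metric.sphere (0 : E) 1)) {x₀ : M}
    {e : Metric.sphere (0 : E) 1} (hg : g x₀ = e) :
    ∃ H : C(unitInterval × M, Metric.sphere (0 : E) 1),
      (∀ x, H (0, x) = g x) ∧ (∀ t, H (t, x₀) = e) ∧
      (∀ x, ‖(g x : E) - e‖ < 1 / 2 → H (1, x) = e) ∧
      (∀ t x, 1 ≤ ‖(g x : E) - e‖ → H (t, x) = g x) := by
  have he : ‖(e : E)‖ = 1 := mem_sphere_zero_iff_norm.mp e.2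
  have hgq : ∀ x, ‖(g x : E)‖ = 1 := fun x ↦ mem_sphere_zero_iff_norm.mp (g x).2
  -- the cut-off profile `ρ` and the cut-off `φ = ρ ∘ ‖g - e‖`
  set ρ : ℝ → ℝ := fun r ↦ max 0 (min 1 (2 - 2 * r)) with hρ
  have hρc : Continuous ρ :=
    continuous_const.max (continuous_const.min (continuous_const.sub
      (continuous_const.mul continuous_id)))
  have hρ0 : ∀ r, 0 ≤ ρ r := fun r ↦ le_max_left _ _
  have hρ1 : ∀ r, ρ r ≤ 1 := fun r ↦ max_le zero_le_one (min_le_left _ _)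
  have hρ_one : ∀ r, r ≤ 1 / 2 → ρ r = 1 := fun r hr ↦ by
    have : min 1 (2 - 2 * r) = 1 := min_eq_left (by linarith)
    simp [hρ, this]
  have hρ_zero : ∀ r, 1 ≤ r → ρ r = 0 := fun r hr ↦ by
    have : min 1 (2 - 2 * r) ≤ 0 := (min_le_right _ _).trans (by linarith)
    simp [hρ, max_eq_left this]
  set φ : M → ℝ := fun x ↦ ρ ‖(g x : E) - e‖ with hφ
  have hφc : Continuous φ :=
    hρc.comp ((continuous_subtype_val.comp g.continuous).sub continuous_const).norm
  -- the straight line `(1 - tφ) g + tφ e` and its non-vanishing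
  set v : unitInterval × M → E :=
    fun p ↦ (1 - (p.1 : ℝ) * φ p.2) • (g p.2 : E) + ((p.1 : ℝ) * φ p.2) • (e : E) with hv
  have hvc : Continuous v := by
    have ht : Continuous fun p : unitInterval × M ↦ (p.1 : ℝ) :=
      continuous_subtype_val.comp continuous_fst
    have hs : Continuous fun p : unitInterval × M ↦ (p.1 : ℝ) * φ p.2 :=
      ht.mul (hφc.comp continuous_snd)
    exact ((continuous_const.sub hs).smul
      (continuous_subtype_val.comp (g.continuous.comp continuous_snd))).add
      (hs.smul continuous_const)
  have hv_ne : ∀ p, v p ≠ 0 := by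
    rintro ⟨t, x⟩
    refine segment_sphere_ne_zero (hgq x) he (mul_nonneg t.2.1 (hρ0 _))
      (mul_le_one₀ t.2.2 (hρ0 _) (hρ1 _)) ?_
    by_cases hx : φ x = 0
    · exact Or.inl (by simp [hx])
    · refine Or.inr (ne_neg_of_norm_sub_lt_one he (not_le.mp fun hle ↦ hx ?_))
      exact hρ_zero _ hle
  -- the radial push-back to the sphere
  have hN : ∀ p, ‖v p‖⁻¹ • v p ∈ Metric.sphere (0 : E) 1 := fun p ↦ by
    rw [mem_sphere_zero_iff_norm, norm_smul, norm_inv, norm_norm,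
      inv_mul_cancel₀ (norm_ne_zero_iff.mpr (hv_ne p))]
  have hNc : Continuous fun p ↦ (⟨‖v p‖⁻¹ • v p, hN p⟩ : Metric.sphere (0 : E) 1) :=
    ((hvc.norm.inv₀ fun p ↦ norm_ne_zero_iff.mpr (hv_ne p)).smul hvc).subtype_mk _
  -- where the line sits at a point of the sphere, the push-back is that point
  have hfix : ∀ p (q : Metric.sphere (0 : E) 1), v p = q →
      (⟨‖v p‖⁻¹ • v p, hN p⟩ : Metric.sphere (0 : E) 1) = q := fun p q hpq ↦ by
    ext1
    simp only [hpq, mem_sphere_zero_iff_norm.mp q.2, inv_one, one_smul]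
  refine ⟨⟨_, hNc⟩, fun x ↦ hfix _ _ ?_, fun t ↦ hfix _ _ ?_, fun x hx ↦ hfix _ _ ?_,
    fun t x hx ↦ hfix _ _ ?_⟩
  · -- t = 0
    simp [hv]
  · -- x = x₀ : g x₀ = e
    simp only [hv, hg]
    rw [← add_smul, sub_add_cancel, one_smul]
  · -- t = 1 and φ x = 1
    have : φ x = 1 := hρ_one _ hx.le
    simp [hv, this]
  · -- φ x = 0
    have : φ x = 0 := hρ_zero _ hx
    simp [hv, this]

/-- **Every based map into a sphere is joined, through based maps, to one that is constant `= e`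
near the base point** — the path-in-the-mapping-space form of `exists_homotopy_based_eq_near`
(compact-open topology; the path is the curried homotopy).  This is the printed normalisation
"any section can be normalized to be the identity on a disk `D` containing the base point" as a
statement inside the based gauge group. [cite: DeMichelisFreedman1992, §2 Lemma 2.3 (proof), p. 233] -/
theorem exists_joinedIn_based_eq_near (g : C(M, Metric.sphere (0 : E) 1)) {x₀ : M}
    {e : Metric.sphere (0 : E) 1} (hg : g x₀ = e) :
    ∃ g' : C(M, Metric.sphere (0 : E) 1), (∀ᶠ x in 𝓝 x₀, g' x = e) ∧
      JoinedIn {f : C(M, Metric.sphere (0 : E) 1) | f x₀ = e} g g' := by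
  obtain ⟨H, h0, hb, h1, -⟩ := exists_homotopy_based_eq_near g hg
  refine ⟨H.curry 1, ?_, ?_⟩
  · have hU : {x | ‖(g x : E) - e‖ < 1 / 2} ∈ 𝓝 x₀ := by
      refine IsOpen.mem_nhds ?_ (by simp [hg])
      exact isOpen_lt ((continuous_subtype_val.comp g.continuous).sub continuous_const).norm
        continuous_const
    filter_upwards [hU] with x hx
    simpa using h1 x hx
  · refine ⟨{ toContinuousMap := H.curry, source' := ?_, target' := rfl }, fun t ↦ ?_⟩
    · exact ContinuousMap.ext fun x ↦ by simpa using h0 x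
    · show H.curry t x₀ = e
      simpa using hb t

/-- **Lemma 2.3's reduction to normalised sections** (trivialised bundles, fibre a unit sphere):
if any two based maps `M → S(E)` that are BOTH constant `= e` near the base point are joined by an
arc of based maps, then the space of based maps is path connected — every based map is first
normalised near `x₀` (`exists_joinedIn_based_eq_near`).
[cite: DeMichelisFreedman1992, §2 Lemma 2.3 (proof), p. 233] -/
theorem isPathConnected_based_of_normalised (x₀ : M) (e : Metric.sphere (0 : E) 1)
    (h : ∀ g g' : C(M, Metric.sphere (0 : E) 1), (∀ᶠ x in 𝓝 x₀, g x = e) →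
      (∀ᶠ x in 𝓝 x₀, g' x = e) →
      JoinedIn {f : C(M, Metric.sphere (0 : E) 1) | f x₀ = e} g g') :
    IsPathConnected {f : C(M, Metric.sphere (0 : E) 1) | f x₀ = e} := by
  refine ⟨ContinuousMap.const M e, rfl, fun {f} hf ↦ ?_⟩
  obtain ⟨f', hf', hff'⟩ := exists_joinedIn_based_eq_near f hf
  exact ((h _ _ (Eventually.of_forall fun _ ↦ rfl) hf').trans hff'.symm)

/-- **The printed sentence for `Ad_{SU(2)}`** ("Since `SU(2)` is [locally] connected, any section
can be normalized to be the identity on a disk `D` containing the base point of `M`"): a based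
section `g : M → S³ = SU(2)` (`g x₀ = 1`) of the trivialised bundle is joined, through based
sections, to one that is identically `1` on a neighbourhood of `x₀`.
[cite: DeMichelisFreedman1992, §2 Lemma 2.3 (proof), p. 233] -/
theorem exists_joinedIn_based_eq_one_near (g : C(M, Metric.sphere (0 : ℍ) 1)) {x₀ : M}
    (hg : g x₀ = 1) :
    ∃ g' : C(M, Metric.sphere (0 : ℍ) 1), (∀ᶠ x in 𝓝 x₀, g' x = 1) ∧
      JoinedIn {f : C(M, Metric.sphere (0 : ℍ) 1) | f x₀ = 1} g g' :=
  exists_joinedIn_based_eq_near g hg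

/-- **Lemma 2.3's chain of reductions, assembled** (trivialised bundles over a simply connected,
locally path connected base): the pointed gauge group `𝒢₀` — based sections of `Ad_{SO(3)}` — is
path connected as soon as any two based sections of `Ad_{SU(2)}` that are the identity near the base
point are joined by an arc of based sections ("it is sufficient to check that `Γ(Ad_{SU(2)})` is
connected" + "any section can be normalized to be the identity on a disk `D`"; the remaining input,
`π₀ Maps(M, S³)_* = 0`, is the cited [10, Prop. (5.12)] and is not rendered).
[cite: DeMichelisFreedman1992, §2 Lemma 2.3 (proof), p. 233] -/
theorem isPathConnected_based_SO3_of_normalised [SimplyConnectedSpace M]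
    [LocallyPathConnectedSpace M] (x₀ : M)
    (h : ∀ g g' : C(M, Metric.sphere (0 : ℍ) 1), (∀ᶠ x in 𝓝 x₀, g x = 1) →
      (∀ᶠ x in 𝓝 x₀, g' x = 1) →
      JoinedIn {f : C(M, Metric.sphere (0 : ℍ) 1) | f x₀ = 1} g g') :
    IsPathConnected {f : C(M, SO3) | f x₀ = 1} :=
  isPathConnected_based_SO3_of_sphere x₀ (isPathConnected_based_of_normalised x₀ 1 h)

end Normalisation

end Literature.Barriers.SmoothPoincare4
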